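import Literature.Analysis.SpecialFunctions.ArgAffineLineDerivatives
import Literature.Analysis.Calculus.IteratedDerivCompBound
import Literature.MathematicalPhysics.QuantumLattice.SectorWeightRelativeAngle
import HarnessLib

/-!
# Angular sector cutoffs along lines in momentum space: `h`-uniform all-order derivative bounds

Topic `MathematicalPhysics/QuantumLattice`.  Benfatto–Giuliani–Mastropietro 2006, §2.5 (2.45)–(2.46) and §2.7
(2.66)–(2.71a): the sector decomposition multiplies propagator symbols and kernels by the ANGULAR cutoffs
`ζ̃_{h,ω}(θ(k⃗))` (`sectorWeightCirc n ω (polarAngle k⃗)`, width `w_n = π2^{-n} = πγ^{h/2}`) and by the fat cutoffs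
`F̃` built from them, and "the same bounds" (Lemma 2.2) are claimed for the products.  Their content along a line
`t ↦ k⃗ + t w⃗` is PROVED here: on the Fermi region (`‖k⃗‖ ≥ r₀`) and off the cut of the relative angle,

  **`‖∂ₜⁱ ζ̃_{n,ω}(θ(q⃗ + t w⃗))‖ ≤ B ((1 + N!/w_n) ‖w⃗‖ / r₀)ⁱ ≤ B ((1 + N!) 2ⁿ ‖w⃗‖ / r₀)ⁱ`**  (`i ≤ N`),

with `B` independent of `n, ω`, the base angle, the line and `r₀`
(`exists_norm_iteratedDeriv_sectorWeightCirc_polarAngle_line_le`).  Since `2ⁿ‖w⃗‖ ≤ 2ρ(w)` for the direction cost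
`ρ(w) = 4ⁿ|w₀| + 4ⁿ|⟨n, w⃗⟩| + 2ⁿ|⟨τ, w⃗⟩|` of ANY sector frame, angular factors are in the symbol class of
`TorusSymbolClassDecay` without a `4ⁿ` prefactor.

Method: `ζ̃_{n,ω}(θ(k⃗)) = Z(Θ/w_n)` with the RESCALED profile `Z(x) = ζ̃_{n,ω}(θ₀ + w_n x)` (derivatives bounded
uniformly in `n`, `abs_iteratedDeriv_sectorWeightCirc_le`) and the relative angle `Θ = arg((k₁+ik₂)e^{-iθ₀})`
(`sectorRelAngle`), which along the line is `arg(a + tb)` with `‖∂ₜⁱ arg(a+tb)‖ ≤ (i-1)!‖b‖ⁱ/‖a+tb‖ⁱ`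
(`ArgAffineLineDerivatives`); Faà di Bruno (`IteratedDerivCompBound`).

Everything is proved; no definitions, no named facts.

## Sources

G. Benfatto, A. Giuliani, V. Mastropietro, Ann. Henri Poincaré 7 (2006) 809–898, §2.5 Lemma 2.2, §2.7 (2.71a)
(`BenfattoGiulianiMastropietro2006`).
-/

noncomputable section

open Real Set Filter Complex Literature.Analysis.SpecialFunctions Literature.Analysis.Calculus
open scoped Nat Topology

namespace Literature.MathematicalPhysics.QuantumLattice

/-! ### The line in the complex picture -/

/-- `k⃗ ↦ k₁ + ik₂` is affine along lines: `(q⃗ + t w⃗)↦ (q₁+iq₂) + t(w₁+iw₂)`. [folklore] -/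
theorem momToComplex_add_smul (q w : Fin 2 → ℝ) (t : ℝ) :
    momToComplex (q + t • w) = momToComplex q + (t : ℂ) * momToComplex w := by
  apply Complex.ext <;> simp [momToComplex, Complex.equivRealProdCLM_symm_apply]

/-- The rotated line: `(k₁+ik₂)(q⃗ + t w⃗) e^{-iθ₀} = a + tb`. [folklore] -/
theorem momToComplex_add_smul_mul_exp (θ₀ : ℝ) (q w : Fin 2 → ℝ) (t : ℝ) :
    momToComplex (q + t • w) * exp (-(θ₀ * I)) =
      momToComplex q * exp (-(θ₀ * I)) + (t : ℂ) * (momToComplex w * exp (-(θ₀ * I))) := by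
  rw [momToComplex_add_smul]; ring

/-- Rotation does not change the norm: `‖z e^{-iθ₀}‖ = ‖z‖`. [folklore] -/
theorem norm_mul_exp_neg_mul_I (z : ℂ) (θ₀ : ℝ) : ‖z * exp (-(θ₀ * I))‖ = ‖z‖ := by
  rw [norm_mul, show -((θ₀ : ℂ) * I) = ((-θ₀ : ℝ) : ℂ) * I by push_cast; ring, Complex.norm_exp_ofReal_mul_I,
    mul_one]

/-! ### The rescaled angular profile -/

/-- Derivatives of the rescaled profile `Z(x) = ζ̃_{n,ω}(θ₀ + w_n x)`: `Z^{(m)}(y) = w_nᵐ ζ̃^{(m)}(θ₀ + w_n y)`. [folklore] -/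
theorem iteratedDeriv_sectorWeightCirc_rescaled (n : ℕ) (ω : ℤ) (θ₀ : ℝ) (m : ℕ) (y : ℝ) :
    iteratedDeriv m (fun x : ℝ => sectorWeightCirc n ω (θ₀ + sectorWidth n * x)) y =
      sectorWidth n ^ m * iteratedDeriv m (sectorWeightCirc n ω) (θ₀ + sectorWidth n * y) := by
  have hf : ContDiff ℝ m (fun z : ℝ => sectorWeightCirc n ω (θ₀ + z)) :=
    (contDiff_sectorWeightCirc n ω).comp (contDiff_const.add contDiff_id)
  have h1 := congrFun (iteratedDeriv_comp_const_mul (f := fun z : ℝ => sectorWeightCirc n ω (θ₀ + z)) hf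
    (sectorWidth n)) y
  have h2 := congrFun (iteratedDeriv_comp_const_add m (sectorWeightCirc n ω) θ₀) (sectorWidth n * y)
  rw [h1, h2]

/-- **The rescaled profile has `n`-uniform derivative bounds**: for every `N` there is `G ≥ 0` with
`‖Z^{(m)}(y)‖ ≤ G` for all `m ≤ N`, all `n, ω, θ₀, y`. [cite: BenfattoGiulianiMastropietro2006, §2.5 Lemma 2.2] -/
theorem exists_norm_iteratedDeriv_profile_le (N : ℕ) :
    ∃ G : ℝ, 0 ≤ G ∧ ∀ (m : ℕ), m ≤ N → ∀ (n : ℕ) (ω : ℤ) (θ₀ y : ℝ),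
      ‖iteratedDeriv m (fun x : ℝ => sectorWeightCirc n ω (θ₀ + sectorWidth n * x)) y‖ ≤ G := by
  -- one order at a time
  have single : ∀ m : ℕ, ∃ G : ℝ, 0 ≤ G ∧ ∀ (n : ℕ) (ω : ℤ) (θ₀ y : ℝ),
      ‖iteratedDeriv m (fun x : ℝ => sectorWeightCirc n ω (θ₀ + sectorWidth n * x)) y‖ ≤ G := by
    intro m
    obtain ⟨C, hC0, hC⟩ := abs_iteratedDeriv_sectorWeightCirc_le m
    refine ⟨C, hC0, fun n ω θ₀ y => ?_⟩
    have hw := sectorWidth_pos n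
    rw [iteratedDeriv_sectorWeightCirc_rescaled, norm_mul, norm_pow, Real.norm_of_nonneg hw.le, Real.norm_eq_abs]
    calc sectorWidth n ^ m * |iteratedDeriv m (sectorWeightCirc n ω) (θ₀ + sectorWidth n * y)|
        ≤ sectorWidth n ^ m * (C * (sectorWidth n)⁻¹ ^ m) := mul_le_mul_of_nonneg_left (hC n ω _) (by positivity)
      _ = C := by rw [inv_pow, ← mul_assoc, mul_comm _ C, mul_assoc, mul_inv_cancel₀ (by positivity), mul_one]
  induction N with
  | zero =>
    obtain ⟨G, hG0, hG⟩ := single 0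
    exact ⟨G, hG0, fun m hm n ω θ₀ y => by rw [Nat.le_zero.1 hm]; exact hG n ω θ₀ y⟩
  | succ N ih =>
    obtain ⟨G₁, hG₁0, hG₁⟩ := ih
    obtain ⟨G₂, _, hG₂⟩ := single (N + 1)
    refine ⟨max G₁ G₂, le_max_of_le_left hG₁0, fun m hm n ω θ₀ y => ?_⟩
    rcases Nat.lt_or_ge m (N + 1) with h | h
    · exact (hG₁ m (Nat.lt_succ_iff.1 h) n ω θ₀ y).trans (le_max_left _ _)
    · rw [le_antisymm hm h]; exact (hG₂ n ω θ₀ y).trans (le_max_right _ _)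

/-! ### The rescaled relative angle along the line -/

/-- **The inner function**: `f(t) = w_n⁻¹ arg(a + tb)` has `‖f^{(i)}(t)‖ ≤ ((1 + N!/w_n)‖b‖/r₀)ⁱ` for
`1 ≤ i ≤ N` where `a + tb` is off the cut and `‖a + tb‖ ≥ r₀ > 0`. [folklore] -/
theorem norm_iteratedDeriv_inner_le {a b : ℂ} {t : ℝ} (ht : a + (t : ℂ) * b ∈ slitPlane) {r₀ : ℝ} (hr₀ : 0 < r₀)
    (hr : r₀ ≤ ‖a + (t : ℂ) * b‖) (n N : ℕ) {i : ℕ} (hi1 : 1 ≤ i) (hiN : i ≤ N) :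
    ‖iteratedDeriv i (fun t : ℝ => (sectorWidth n)⁻¹ * arg (a + (t : ℂ) * b)) t‖ ≤
      ((1 + (sectorWidth n)⁻¹ * N !) * ‖b‖ / r₀) ^ i := by
  obtain ⟨j, rfl⟩ : ∃ j, i = j + 1 := ⟨i - 1, by omega⟩
  have hw := sectorWidth_pos n
  have hcd : ContDiffAt ℝ (j + 1 : ℕ) (fun t : ℝ => arg (a + (t : ℂ) * b)) t :=
    (contDiffOn_arg_affine a b t ht).contDiffAt ((isOpen_affine_preimage_slitPlane a b).mem_nhds ht)
  rw [iteratedDeriv_const_mul _ hcd, norm_mul, norm_inv, Real.norm_of_nonneg hw.le]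
  have h1 := norm_iteratedDeriv_arg_affine_le a b j ht
  have hjN : (j ! : ℝ) ≤ N ! := by exact_mod_cast Nat.factorial_le (by omega)
  have hb0 : 0 ≤ ‖b‖ := norm_nonneg _
  have hu0 : 0 < ‖a + (t : ℂ) * b‖ := hr₀.trans_le hr
  -- `j! ‖b‖^{j+1}/‖u‖^{j+1} ≤ N! (‖b‖/r₀)^{j+1}`
  have h2 : (j ! : ℝ) * ‖b‖ ^ (j + 1) / ‖a + (t : ℂ) * b‖ ^ (j + 1) ≤ N ! * (‖b‖ / r₀) ^ (j + 1) := by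
    rw [div_pow, mul_div_assoc]
    refine mul_le_mul hjN (div_le_div_of_nonneg_left (by positivity) (by positivity)
      (pow_le_pow_left₀ hr₀.le hr _)) (by positivity) (by positivity)
  -- `w⁻¹ N! ≤ (1 + w⁻¹ N!)^{j+1}`
  have h3 : (sectorWidth n)⁻¹ * N ! ≤ (1 + (sectorWidth n)⁻¹ * N !) ^ (j + 1) := by
    have h1x : 1 ≤ 1 + (sectorWidth n)⁻¹ * (N ! : ℝ) := le_add_of_nonneg_right (by positivity)
    calc (sectorWidth n)⁻¹ * (N ! : ℝ) ≤ 1 + (sectorWidth n)⁻¹ * N ! := le_add_of_nonneg_left zero_le_one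
      _ ≤ (1 + (sectorWidth n)⁻¹ * N !) ^ (j + 1) := le_self_pow₀ h1x (by omega)
  calc (sectorWidth n)⁻¹ * ‖iteratedDeriv (j + 1) (fun t : ℝ => arg (a + (t : ℂ) * b)) t‖
      ≤ (sectorWidth n)⁻¹ * ((N ! : ℝ) * (‖b‖ / r₀) ^ (j + 1)) := mul_le_mul_of_nonneg_left (h1.trans h2) (by positivity)
    _ = ((sectorWidth n)⁻¹ * N !) * (‖b‖ / r₀) ^ (j + 1) := by ring
    _ ≤ (1 + (sectorWidth n)⁻¹ * N !) ^ (j + 1) * (‖b‖ / r₀) ^ (j + 1) :=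
        mul_le_mul_of_nonneg_right h3 (by positivity)
    _ = ((1 + (sectorWidth n)⁻¹ * N !) * ‖b‖ / r₀) ^ (j + 1) := by rw [← mul_pow, mul_div_assoc]

/-- `1 + N!/w_n ≤ (1 + N!) 2ⁿ` (`w_n = π/2ⁿ ≥ 2^{-n}`). [folklore] -/
theorem one_add_inv_sectorWidth_mul_le (n N : ℕ) : 1 + (sectorWidth n)⁻¹ * (N ! : ℝ) ≤ (1 + N !) * 2 ^ n := by
  have h2n : (1 : ℝ) ≤ 2 ^ n := one_le_pow₀ (by norm_num)
  have hinv : (sectorWidth n)⁻¹ ≤ (2 : ℝ) ^ n := by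
    rw [sectorWidth, inv_div, div_le_iff₀ pi_pos]
    exact le_mul_of_one_le_right (by positivity) (by linarith [Real.two_le_pi])
  have hN : (0 : ℝ) ≤ N ! := by positivity
  nlinarith [mul_le_mul_of_nonneg_right hinv hN]

/-! ### The main estimate -/

/-- **Angular sector cutoffs along lines, all orders, uniformly in the scale**: for every `N` there is `B ≥ 0`
such that for all `i ≤ N`, all `n`, `ω`, base angles `θ₀`, lines `q⃗ + t w⃗` and `r₀ > 0` with
`‖q⃗ + t w⃗‖ ≥ r₀` and relative angle `|Θ_{θ₀}(q⃗ + t w⃗)| < π` (off the cut),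
`‖∂ₜⁱ ζ̃_{n,ω}(θ(q⃗ + t w⃗))‖ ≤ B ((1 + N!/w_n) ‖w⃗‖ / r₀)ⁱ`. [cite: BenfattoGiulianiMastropietro2006, §2.5 Lemma 2.2] -/
theorem exists_norm_iteratedDeriv_sectorWeightCirc_polarAngle_line_le (N : ℕ) :
    ∃ B : ℝ, 0 ≤ B ∧ ∀ (i : ℕ), i ≤ N → ∀ (n : ℕ) (ω : ℤ) (θ₀ : ℝ) (q w : Fin 2 → ℝ) (t : ℝ) {r₀ : ℝ}, 0 < r₀ →
      r₀ ≤ ‖momToComplex (q + t • w)‖ → |sectorRelAngle θ₀ (q + t • w)| < π →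
      ‖iteratedDeriv i (fun t : ℝ => sectorWeightCirc n ω (polarAngle (q + t • w))) t‖ ≤
        N ! * B * ((1 + (sectorWidth n)⁻¹ * N !) * ‖momToComplex w‖ / r₀) ^ i := by
  obtain ⟨G, hG0, hG⟩ := exists_norm_iteratedDeriv_profile_le N
  refine ⟨G, hG0, fun i hi n ω θ₀ q w t r₀ hr₀ hr hΘ => ?_⟩
  -- the rotated line `u(s) = a + s b`
  obtain ⟨a, ha⟩ : ∃ a : ℂ, a = momToComplex q * exp (-(θ₀ * I)) := ⟨_, rfl⟩
  obtain ⟨b, hb⟩ : ∃ b : ℂ, b = momToComplex w * exp (-(θ₀ * I)) := ⟨_, rfl⟩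
  have hu : ∀ s : ℝ, momToComplex (q + s • w) * exp (-(θ₀ * I)) = a + (s : ℂ) * b := fun s => by
    rw [ha, hb]; exact momToComplex_add_smul_mul_exp θ₀ q w s
  have hnb : ‖b‖ = ‖momToComplex w‖ := by rw [hb, norm_mul_exp_neg_mul_I]
  have hnu : ‖a + (t : ℂ) * b‖ = ‖momToComplex (q + t • w)‖ := by rw [← hu, norm_mul_exp_neg_mul_I]
  have harg : ∀ s : ℝ, arg (a + (s : ℂ) * b) = sectorRelAngle θ₀ (q + s • w) := fun s => by
    rw [← hu]; rfl
  -- `u(t)` is off the cut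
  have ht : a + (t : ℂ) * b ∈ slitPlane := by
    refine mem_slitPlane_iff_arg.2 ⟨?_, ?_⟩
    · rw [harg]; exact fun h => (abs_lt.1 hΘ).2.ne h
    · rw [← norm_pos_iff, hnu]; exact hr₀.trans_le hr
  have hU := isOpen_affine_preimage_slitPlane a b
  have hw := sectorWidth_pos n
  -- Faà di Bruno for `Z ∘ f`
  have hg : ContDiff ℝ N (fun x : ℝ => sectorWeightCirc n ω (θ₀ + sectorWidth n * x)) :=
    (contDiff_sectorWeightCirc n ω).comp (contDiff_const.add (contDiff_const.mul contDiff_id))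
  have hf : ContDiffOn ℝ N (fun s : ℝ => (sectorWidth n)⁻¹ * arg (a + (s : ℂ) * b)) {s : ℝ | a + (s : ℂ) * b ∈ slitPlane} :=
    contDiffOn_const.mul (contDiffOn_arg_affine a b)
  have hD0 : 0 ≤ (1 + (sectorWidth n)⁻¹ * N !) * ‖momToComplex w‖ / r₀ := by positivity
  have hcomp := norm_iteratedDeriv_comp_le_of_contDiffOn_of_le (g := fun x : ℝ => sectorWeightCirc n ω (θ₀ + sectorWidth n * x))
    (f := fun s : ℝ => (sectorWidth n)⁻¹ * arg (a + (s : ℂ) * b)) hU ht hg hf hG0 hD0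
    (fun m hm y => hG m hm n ω θ₀ y)
    (fun j hj1 hjN => by rw [← hnb]; exact norm_iteratedDeriv_inner_le ht hr₀ (hnu ▸ hr) n N hj1 hjN) hi
  -- the factor IS `Z ∘ f` near `t`
  have hev : (fun s : ℝ => sectorWeightCirc n ω (polarAngle (q + s • w))) =ᶠ[𝓝 t]
      ((fun x : ℝ => sectorWeightCirc n ω (θ₀ + sectorWidth n * x)) ∘ fun s : ℝ => (sectorWidth n)⁻¹ * arg (a + (s : ℂ) * b)) := by
    filter_upwards [hU.mem_nhds ht] with s hs
    have hk : q + s • w ≠ 0 := by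
      intro h0
      have : a + (s : ℂ) * b = 0 := by
        rw [← hu, h0]
        simp [momToComplex]
      exact (mem_slitPlane_iff_arg.1 hs).2 this
    obtain ⟨m, hm⟩ := polarAngle_eq_add_sectorRelAngle θ₀ hk
    simp only [Function.comp_apply]
    rw [mul_inv_cancel_left₀ hw.ne', harg, hm, show θ₀ + sectorRelAngle θ₀ (q + s • w) + 2 * π * m =
      θ₀ + sectorRelAngle θ₀ (q + s • w) + (m : ℝ) * (2 * π) by ring]
    exact (periodic_sectorWeightCirc n ω).int_mul m _
  rw [(hev.iteratedDeriv i).eq_of_nhds]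
  exact hcomp

/-- The same bound with the direction cost `2ⁿ‖w⃗‖`: `≤ N! B ((1 + N!) 2ⁿ ‖w⃗‖ / r₀)ⁱ`. [cite: BenfattoGiulianiMastropietro2006, §2.5 Lemma 2.2] -/
theorem exists_norm_iteratedDeriv_sectorWeightCirc_polarAngle_line_le' (N : ℕ) :
    ∃ B : ℝ, 0 ≤ B ∧ ∀ (i : ℕ), i ≤ N → ∀ (n : ℕ) (ω : ℤ) (θ₀ : ℝ) (q w : Fin 2 → ℝ) (t : ℝ) {r₀ : ℝ}, 0 < r₀ →
      r₀ ≤ ‖momToComplex (q + t • w)‖ → |sectorRelAngle θ₀ (q + t • w)| < π →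
      ‖iteratedDeriv i (fun t : ℝ => sectorWeightCirc n ω (polarAngle (q + t • w))) t‖ ≤
        B * ((1 + N !) * (2 : ℝ) ^ n * ‖momToComplex w‖ / r₀) ^ i := by
  obtain ⟨B, hB0, hB⟩ := exists_norm_iteratedDeriv_sectorWeightCirc_polarAngle_line_le N
  refine ⟨N ! * B, by positivity, fun i hi n ω θ₀ q w t r₀ hr₀ hr hΘ => (hB i hi n ω θ₀ q w t hr₀ hr hΘ).trans ?_⟩
  have hw := sectorWidth_pos n
  have hD0 : 0 ≤ (1 + (sectorWidth n)⁻¹ * N !) * ‖momToComplex w‖ / r₀ := by positivity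
  refine mul_le_mul_of_nonneg_left (pow_le_pow_left₀ hD0 ?_ i) (by positivity)
  exact div_le_div_of_nonneg_right (mul_le_mul_of_nonneg_right (one_add_inv_sectorWidth_mul_le n N) (norm_nonneg _))
    hr₀.le

end Literature.MathematicalPhysics.QuantumLattice
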